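import Summits.CriticalPhenomena.PercolationContinuityZ3.Theorems.PercNearOneGluingAdditiveGluingKnThm2GoodAux
import Summits.CriticalPhenomena.PercolationContinuityZ3.Theorems.PercNearOneGluingAdditiveGluingBhkSets
import HarnessLib

/-! # Crux `PercNearOneGluing.AdditiveGluing` (stmt-CriticalPhenomena-4576), line `starglue/tieline`
(skeleton v12) — stub `stub_bhkOneAny_c7` (BHK Thm. 1.3, set form, "ANY" shape)

Helper file for the crux skeleton of the line `tieline` (lead
prover-line-stmt-CriticalPhenomena-4576-c7-0): proves exactly the registered stub signature
`stub_bhkOneAny_c7`; lands with `--supports stmt-CriticalPhenomena-4576`.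

## Content

Finite weighted graph on `Fin n` (`μ = prodBernoulli w` on `BondConfig (Fin n)`, events
`{x ↔ y} = openConn x y`), a vertex set `S`, a set `X` avoided by `S`, and two targets `o, b`.
With `D := {S ↮ X} = {ω | ∀ s ∈ S, ∀ x ∈ X, s ↮ x}` and `{S ↔ v} := ⋃_{s ∈ S} {s ↔ v}`:

`μ(D ∩ {S ↔ o}) · μ(D ∩ {S ↔ b}) ≤ μ(D) · μ(D ∩ {S ↔ o} ∩ {S ↔ b})`,

i.e. given `D` the two increasing functions `1{S ↔ o}`, `1{S ↔ b}` of the cluster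
`C_S = ⋃_{s ∈ S} C_s` are positively correlated (van den Berg–Häggström–Kahn 2006, Thm. 1.3, for the
cluster of a vertex SET; the form of Kozma–Nitzan, arXiv:2401.12397, Lemma 1 (i), p. 5).

Proof: the sibling `knThm2_bhkOne` (file `…KnThm2GoodAux`) verbatim, with the second increasing
function replaced by the any-reach indicator `knThm2_monotone_anyReach S b`, and the general set-BHK
hypothesis `hB1` discharged by the first half of the landed `stub_bhkSets` (file `…BhkSets`);
`μ.real` bookkeeping by `knThm2_setIntegral_indicator`.
-/

namespace Summit.CriticalPhenomena.PercolationContinuityZ3.Theorems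

open MeasureTheory Set Literature.Probability.LatticeModels Literature.Probability.Percolation

noncomputable section
open Classical

/-- **BHK 2006 Thm. 1.3 for the cluster of a vertex set `S`, with `f = 1{S ↔ o}`, `g = 1{S ↔ b}`
(both of the "some `s ∈ S` is joined to" shape):**
`μ(D ∩ {S ↔ o}) μ(D ∩ {S ↔ b}) ≤ μ(D) μ(D ∩ {S ↔ o} ∩ {S ↔ b})`, `D = {S ↮ X}`, unconditionally
(the general inequality is the landed `stub_bhkSets.1`).
[cite: VandenbergHaggstromKahn2005, Thm. 1.3 (p. 6)] -/
theorem stub_bhkOneAny_c7 : ∀ (n : ℕ) (w : Sym2 (Fin n) → unitInterval) (S : Finset (Fin n)) (X : Set (Fin n)) (o b : Fin n),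
    (∀ s ∈ S, s ∉ X) →
    (prodBernoulli w).real
          ({ω : BondConfig (Fin n) | ∀ s ∈ S, ∀ x ∈ X, ¬ (openGraph ω).Reachable s x} ∩ ⋃ s ∈ S, openConn s o) *
        (prodBernoulli w).real
          ({ω : BondConfig (Fin n) | ∀ s ∈ S, ∀ x ∈ X, ¬ (openGraph ω).Reachable s x} ∩ ⋃ s ∈ S, openConn s b) ≤
      (prodBernoulli w).real {ω : BondConfig (Fin n) | ∀ s ∈ S, ∀ x ∈ X, ¬ (openGraph ω).Reachable s x} *
        (prodBernoulli w).real
          ({ω : BondConfig (Fin n) | ∀ s ∈ S, ∀ x ∈ X, ¬ (openGraph ω).Reachable s x} ∩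
            ((⋃ s ∈ S, openConn s o) ∩ ⋃ s ∈ S, openConn s b)) := by
  intro n w S X o b hSX
  -- adapted from `knThm2_bhkOne` (…KnThm2GoodAux): `G :=` the any-reach indicator for `(S, b)`
  have key := stub_bhkSets.1 n w S X
    ({C : Set (Sym2 (Fin n)) | ∃ s ∈ S, (openGraph C).Reachable s o}.indicator 1)
    ({C : Set (Sym2 (Fin n)) | ∃ s ∈ S, (openGraph C).Reachable s b}.indicator 1)
    (knThm2_monotone_anyReach S o) (knThm2_monotone_anyReach S b) hSX
  simp only [knThm2_anyReach_apply] at key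
  have h := knThm2_setIntegral_indicator w
    {ω : BondConfig (Fin n) | ∀ s ∈ S, ∀ x ∈ X, ¬ (openGraph ω).Reachable s x}
    (⋃ s ∈ S, openConn s o) (⋃ s ∈ S, openConn s b)
  have h' := knThm2_setIntegral_indicator w
    {ω : BondConfig (Fin n) | ∀ s ∈ S, ∀ x ∈ X, ¬ (openGraph ω).Reachable s x}
    (⋃ s ∈ S, openConn s b) (⋃ s ∈ S, openConn s b)
  rw [h.1, h'.1, h.2] at key
  exact key

end

end Summit.CriticalPhenomena.PercolationContinuityZ3.Theorems
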